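import Summits.ResolutionOfSingularities.ResolutionOfSingularities.Theorems.EquisingularLiftEquisingularLiftNatMemberKCLStepRegular
import Summits.ResolutionOfSingularities.ResolutionOfSingularities.Theorems.EquisingularLiftEquisingularLiftNatCarrierExactPointSteps
import Summits.ResolutionOfSingularities.ResolutionOfSingularities.Theorems.EquisingularLiftEquisingularLiftNatStrictTransformFlat
import Summits.ResolutionOfSingularities.ResolutionOfSingularities.Theorems.EquisingularLiftEquisingularLiftNatSubchainSupplierInvSZeroLDefs
import HarnessLib

/-!
# [OURS · L1 W4.5(b) · EL♮(3) · T23-A‴ (U6), SHADOW-FREE ARM] (A)S₀ AT AN EXPLICIT STAGE WITH EXPLICIT OUTPUTS: `memberS₀At_strictTransform_of_regularPoint`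
# — res-type-027's R1 `memberS₀_strictTransform_of_regularPoint` (…NatMemberSZeroStepRegular p620583) restated on `TCPlus.MemberS₀At`
# (…NatSubchainSupplierInvSZeroLDefs) and RETURNING the section `s`, the blow-up `τ`, the model square `(j₂, t₂)` and the `{jG y}`-fibre fact
# (the twin of …NatMemberSAtStepRegular p627057 in the shadow-free arm; res-L1-w45b-stub-4's request 2026-08-28T11:24:07Z)

res-type-027 g18 ((U6) owner), brick (G2). OURS; NOT a statement of any manuscript ([Hironaka2017] is a candidate under adjudication, nothing of it is
asserted); AI-written, weaker than expert review. No `sorry`; standard axioms; DEF-FREE; `--supports stmt-ResolutionOfSingularities-20148 --as helper`.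
PROOF = p620583's VERBATIM (credit for the (A) engine: res-L1-w45b-stub-4 / -stub-1), the final anonymous constructor opened up.
[cite: GortzWedhorn2020, Prop. 13.91 and (13.19)] [cite: Liu2002, Thm. 8.1.19] [cite: Matsumura1987, Thm. 14.2] [cite: StacksProject, Tag 01WS]
-/

set_option linter.dupNamespace false -- mandated namespace `Summit.<Summit>.<Problem>` of this single-conjunct summit
set_option linter.overlappingInstances false -- signatures carry `[IsDomain O] [IsDiscreteValuationRing O]`

noncomputable section

open CategoryTheory CategoryTheory.Limits AlgebraicGeometry TopologicalSpace Topology IsLocalRing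
open Literature.AlgebraicGeometry.Resolution
open AlgebraicGeometry.Scheme.IdealSheafData
open Summit.ResolutionOfSingularities.ResolutionOfSingularities.Theses.EquisingularLift.Split
open Summit.ResolutionOfSingularities.ResolutionOfSingularities.Cruxes.EquisingularLift.StrataSplit
open scoped nonZeroDivisors

namespace Summit.ResolutionOfSingularities.ResolutionOfSingularities.Cruxes.EquisingularLiftNat.Sections

/-- **(A)S₀ at an explicit stage, explicit outputs** (see the module docstring). [cite: Matsumura1987, Thm. 14.2 and Thm. 20.3]
[cite: GortzWedhorn2020, Prop. 13.91 and Prop. 13.96] [cite: Liu2002, Thm. 8.1.19] [cite: StacksProject, Tag 01WS] [OURS · L1 W4.5b · T23-A‴ (U6)] brick (G2)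
(stmt-ResolutionOfSingularities-20148); NOT a statement of the manuscript. -/
theorem memberS₀At_strictTransform_of_regularPoint (O : Type) [CommRing O] [IsDomain O] [IsDiscreteValuationRing O]
    [IsAdicComplete (maximalIdeal O) O] [IsAlgClosed (ResidueField O)] (k : Type) [Field k] (θ : O →+* k)
    (hθ : Function.Surjective θ)
    (P : Scheme.{0}) (q : P ⟶ Spec (.of O)) (Y : Set P) (hY : Y ⊆ q ⁻¹' {closedPoint O}) (hYirr : IsIrreducible Y)
    (hYcl : IsClosed Y) [IsProper q] [IsIntegral P] (hPnoeth : IsLocallyNoetherian P) (hPreg : Scheme.IsRegular P)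
    [SmoothOfRelativeDimension 3 q]
    (Ch : ∀ X' : Scheme.{0}, (X' ⟶ P) → Set X' → Prop)
    (hChain : ∀ (X' : Scheme.{0}) (σ : X' ⟶ P) (S : Set X'), Ch X' σ S → Chain P Y X' σ S)
    (hStep : ∀ (X' X'' : Scheme.{0}) (σ' : X' ⟶ P) (S' : Set X') (C : X'.IdealSheafData) (τ : X'' ⟶ X'),
      Ch X' σ' S' → IsBlowup τ C → Scheme.IsRegular C.subscheme → Flat (C.subschemeι ≫ σ' ≫ q) →
      σ' '' (C.support : Set X') ⊆ {x : P | ¬ IsGenericPoint x Y} →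
      (C.support : Set X') ∩ (σ' ≫ q) ⁻¹' {closedPoint O} ⊆ S' →
      Ch X'' (τ ≫ σ') (closure (τ ⁻¹' (S' \ (C.support : Set X')))))
    -- the package transport (res-D-pv-029's T-PKG-TRANSPORT-SCHEME), used only at the excluded points
    (hpkg : ∀ ⦃X X₂ : Scheme.{0}⦄ [IsIntegral X] [IsLocallyNoetherian X] [IsLocallyNoetherian X₂] (σ : X ⟶ P)
      [IsSeparated (σ ≫ q)], Scheme.IsRegular X → ∀ (s : Spec (.of O) ⟶ X), s ≫ σ ≫ q = 𝟙 _ → ∀ (τ : X₂ ⟶ X), IsBlowup τ s.ker →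
      ∀ (𝓢 K : X.IdealSheafData) (p' : X), p' ∉ (s.ker.support : Set X) → ∀ (p'₂ : X₂), τ p'₂ = p' →
      TCPlus.CentredPackage O P q X σ 𝓢 K p' →
      TCPlus.CentredPackage O P q X₂ (τ ≫ σ) (strictTransformIdeal τ s.ker 𝓢) (strictTransformIdeal τ s.ker K) p'₂)
    -- the member and the point
    (G : Scheme.{0}) [IsIntegral G] (T Z Sd excl : Set G) (X : Scheme.{0}) (σ : X ⟶ P) (S : Set X) (jG : G ⟶ X)
    (tG : G ⟶ Spec (.of k)) (𝓢 K : X.IdealSheafData) (hmem : TCPlus.MemberS₀At O k θ P q Y Ch G T Z Sd excl X σ S jG tG 𝓢 K)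
    (hTirr : IsIrreducible T) (y : G) (hy : IsClosed ({y} : Set G)) (hyZ : y ∈ closure Z) (hyT : y ∈ T) (hTZ : ¬ T ⊆ closure Z)
    (hyexcl : y ∉ excl)
    (hyreg : IsRegularLocalRing (G.presheaf.stalk y ⧸ stalkIdeal (vanishingIdeal ⟨closure Z, isClosed_closure⟩) y))
    (hamb : IsRegularLocalRing (G.presheaf.stalk y))
    (G₂ : Scheme.{0}) (υ₁ : G₂ ⟶ G) (hυ₁ : IsBlowup υ₁ (vanishingIdeal ⟨{y}, hy⟩)) :
    ∃ (s : Spec (.of O) ⟶ X) (X₂ : Scheme.{0}) (τ : X₂ ⟶ X) (j₂ : G₂ ⟶ X₂) (t₂ : G₂ ⟶ Spec (.of k)),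
      s ≫ σ ≫ q = 𝟙 _ ∧ s (closedPoint O) = jG y ∧ IsBlowup τ s.ker ∧ j₂ ≫ τ = υ₁ ≫ jG ∧
      (s.ker.support : Set X) ∩ (σ ≫ q) ⁻¹' {closedPoint O} = {jG y} ∧
      IsIntegral G₂ ∧ IsIrreducible (closure (υ₁ ⁻¹' (T \ {y}))) ∧
      ¬ closure (υ₁ ⁻¹' (T \ {y})) ⊆ closure (closure (υ₁ ⁻¹' (Z \ {y}))) ∧
      TCPlus.MemberS₀At O k θ P q Y Ch G₂ (closure (υ₁ ⁻¹' (T \ {y}))) (closure (υ₁ ⁻¹' (Z \ {y})))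
        (closure (υ₁ ⁻¹' (Sd \ {y}))) (υ₁ ⁻¹' excl) X₂ (τ ≫ σ)
        (closure (τ ⁻¹' (S \ (s.ker.support : Set X)))) j₂ t₂ (strictTransformIdeal τ s.ker 𝓢) (strictTransformIdeal τ s.ker K) := by
  classical
  obtain ⟨hCh, hXint, hXnoeth, hXreg, hdom, hsq, hTS, hi, hii, hiii, hiiip, hiv, hv, hvi, hviii, hix, hSflat⟩ := hmem
  haveI := hXint
  haveI := hXnoeth
  obtain ⟨ϖ, hϖ⟩ := IsDiscreteValuationRing.exists_irreducible O
  -- properness / separatedness / finite type of the stage over `O`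
  obtain ⟨-, -, hσ⟩ := chain_isRegular P Y X σ S (hChain _ _ _ hCh) hPnoeth hPreg
  haveI := hσ
  haveI : IsProper (σ ≫ q) := inferInstance
  -- the model square: `jG` is a closed immersion onto the special fibre
  haveI : IsClosedImmersion (Spec.map (CommRingCat.ofHom θ)) := IsClosedImmersion.spec_of_surjective _ hθ
  haveI hjci : IsClosedImmersion jG := MorphismProperty.IsStableUnderBaseChange.of_isPullback hsq.flip inferInstance
  have hrangej : Set.range jG = (σ ≫ q) ⁻¹' {closedPoint O} := by
    rw [range_eq_preimage_of_isPullback hsq, range_specMap_of_surjective_of_field θ hθ]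
  have hjsp : ∀ y' : G, (σ ≫ q) (jG y') = closedPoint O := fun y' => by
    have h1 : jG y' ∈ Set.range jG := ⟨y', rfl⟩
    rw [hrangej] at h1
    exact h1
  have hjcl : ∀ y' : G, IsClosed ({y'} : Set G) → IsClosed ({jG y'} : Set X) := fun y' hy' => by
    have h1 := hjci.isClosedEmbedding.isClosedMap _ hy'
    rwa [Set.image_singleton] at h1
  -- the point `p = jG y` lies on `D = V(𝓢 ⊔ K)`; the generic point of `Y`
  have hZsupp : ((vanishingIdeal (⟨closure Z, isClosed_closure⟩ : Closeds G)).support : Set G) = closure Z :=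
    Scheme.IdealSheafData.coe_support_vanishingIdeal _
  have hyC : jG y ∈ ((𝓢 ⊔ K).support : Set X) := by
    have h1 : y ∈ (((𝓢 ⊔ K).comap jG).support : Set G) := by rw [hi, hZsupp]; exact hyZ
    rw [Scheme.IdealSheafData.support_comap] at h1
    exact h1
  obtain ⟨hDreg, hDcod⟩ := hv (jG y) hyC (hjsp y) (by
    rintro ⟨y₀, hy₀, he⟩
    exact hyexcl (hjci.isClosedEmbedding.injective he ▸ hy₀))
  have hpcl : IsClosed ({jG y} : Set X) := hjcl y hy
  have hDdim := hDcod hpcl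
  have hreg : IsRegularLocalRing (X.presheaf.stalk (jG y)) := hXreg (jG y)
  have hξ : IsGenericPoint hYirr.genericPoint Y := hYirr.isGenericPoint_genericPoint hYcl
  have hdim : ringKrullDim (X.presheaf.stalk (jG y)) = (3 + 1 : ℕ) :=
    ringKrullDim_stalk_eq_succ_of_chain q 3 hξ (hChain _ _ _ hCh) hpcl (by
      simpa only [Scheme.Hom.comp_base, TopCat.coe_comp, Function.comp_apply] using hjsp y)
  obtain ⟨h𝓢p, hKp⟩ := hiiip (jG y)
  -- (1) the in-carrier section through `jG y`
  have hfib : ∀ y' : ↥((𝓢 ⊔ K).comap jG).subscheme, ((𝓢 ⊔ K).comap jG).subschemeι y' = y →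
      IsRegularLocalRing (((𝓢 ⊔ K).comap jG).subscheme.presheaf.stalk y') := by
    intro y' hy'
    -- `y` as a point of `V(𝓘⟨closure Z⟩)`
    have hyr : y ∈ Set.range (vanishingIdeal (⟨closure Z, isClosed_closure⟩ : Closeds G)).subschemeι := by
      rw [Scheme.IdealSheafData.range_subschemeι, hZsupp]; exact hyZ
    obtain ⟨y₁, hy₁⟩ := hyr
    refine isRegularLocalRing_stalk_subscheme_of_eq hi y' y₁ (hy'.trans hy₁.symm) ?_
    exact (isRegularLocalRing_stalk_subscheme_iff _ y₁).mpr (by rw [hy₁]; exact hyreg)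
  obtain ⟨s, hs, hss₀, hle, -, -⟩ := exists_inCarrier_section O k θ hθ X G (σ ≫ q) jG tG hsq (𝓢 ⊔ K) hii y hy hyC hDreg hfib
  -- (2) the upstairs blow-up and the model point step
  obtain ⟨X₂, τ, hτ⟩ := exists_isBlowup X s.ker
  have hyZ' : y ∈ closure Z := hyZ
  have hTx : ¬ T ⊆ {y} := fun h => hTZ (h.trans (Set.singleton_subset_iff.mpr hyZ'))
  have hw : ¬ IsGenericPoint (σ (jG y)) Y := hiv ⟨jG y, hyC, rfl⟩
  obtain ⟨hCh₂, hX₂reg, hX₂noeth, hX₂int, hdom₂, hG₂int, hirr₂, hJ, -, -, -, j₂, t₂, hsq₂, hcomm, -, hS₂⟩ :=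
    modelPointStep_of_section O k θ hθ P q Y hY hYirr hYcl Ch hChain hStep X σ S hCh hXreg hdom G jG tG hsq T hTS y hy hyT hTx hw
      s hs hss₀ X₂ τ hτ G₂ υ₁ hυ₁
  haveI := hX₂noeth
  haveI := hX₂int
  haveI := hG₂int
  haveI : IsProper τ := hτ.isProper
  -- the centre: `supp ker s = s(Spec O) = {jG y, s η}`
  obtain ⟨_, -, -, hCsupp⟩ := section_isClosedImmersion_and_isRegular_ker O X (σ ≫ q) s hs
  have hrs : ∀ u : Spec (.of O), (σ ≫ q) (s u) = u := fun u => by rw [← Scheme.Hom.comp_apply, hs]; rfl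
  have hexcl_off : ∀ y₀ ∈ excl, jG y₀ ∉ (s.ker.support : Set X) := by
    intro y₀ hy₀ hmem
    rw [hCsupp] at hmem
    obtain ⟨u, hu⟩ := hmem
    have hu' : u = closedPoint O := by rw [← hrs u, hu]; exact hjsp y₀
    rw [hu', hss₀] at hu
    exact hyexcl (hjci.isClosedEmbedding.injective hu ▸ hy₀)
  haveI : IsLocallyNoetherian G := LocallyOfFiniteType.isLocallyNoetherian jG
  haveI : IsProper υ₁ := hυ₁.isProper
  haveI : IsLocallyNoetherian G₂ := LocallyOfFiniteType.isLocallyNoetherian υ₁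
  -- (3) the adapted order-one cone pack at `s(s₀) = jG y`
  have hreg' : IsRegularLocalRing (X.presheaf.stalk (s (closedPoint O))) := by rw [hss₀]; exact hreg
  have hdim' : ringKrullDim (X.presheaf.stalk (s (closedPoint O))) = (3 + 1 : ℕ) := by rw [hss₀]; exact hdim
  have h𝓢p' : (stalkIdeal 𝓢 (s (closedPoint O))).IsPrincipal := by rw [hss₀]; exact h𝓢p
  have hKp' : (stalkIdeal K (s (closedPoint O))).IsPrincipal := by rw [hss₀]; exact hKp
  have hDreg' : IsRegularLocalRing (X.presheaf.stalk (s (closedPoint O)) ⧸ stalkIdeal (𝓢 ⊔ K) (s (closedPoint O))) := by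
    rw [hss₀]; exact hDreg
  have hDdim' : ringKrullDim (X.presheaf.stalk (s (closedPoint O)) ⧸ stalkIdeal (𝓢 ⊔ K) (s (closedPoint O))) + 2 =
      ringKrullDim (X.presheaf.stalk (s (closedPoint O))) := by rw [hss₀]; exact hDdim
  obtain ⟨c, Φ, g, hcJ, hcq, hcdom, hcb, h𝔪c, h𝓢c, hΦ1, hKc, hΦc, hΦ𝔪, hgC, hg0, hCg, h𝓢0⟩ :=
    exists_adaptedConePack O σ q s hs rfl hreg' hdim' ϖ hϖ 𝓢 K hle h𝓢p' hKp' hDreg' hDdim'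
  haveI := hcdom
  -- (i) exact special fibre
  have hi₂ : (strictTransformIdeal τ s.ker 𝓢 ⊔ strictTransformIdeal τ s.ker K).comap j₂ =
      vanishingIdeal ⟨closure (closure (υ₁ ⁻¹' (Z \ {y}))), isClosed_closure⟩ := by
    have e₁ := comap_strictTransformIdeal_carrierPair_eq_sup O k θ hθ (σ ≫ q) jG tG hsq s hs τ hτ υ₁ j₂ hcomm y hy hυ₁ hJ hss₀ hreg ϖ hϖ
      𝓢 K hle h𝓢p hKp hDreg hDdim
    have h𝓢y : (stalkIdeal (𝓢.comap jG) y).IsPrincipal := by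
      rw [stalkIdeal_comap_eq_map_stalkMap]; exact isPrincipal_map_of_isPrincipal _ h𝓢p
    have hKy : (stalkIdeal (K.comap jG) y).IsPrincipal := by
      rw [stalkIdeal_comap_eq_map_stalkMap]; exact isPrincipal_map_of_isPrincipal _ hKp
    have hD : 𝓢.comap jG ⊔ K.comap jG = vanishingIdeal ⟨closure Z, isClosed_closure⟩ := by
      rw [← Scheme.IdealSheafData.comap_sup]; exact hi
    have e₂ := strictTransformIdeal_sup_eq_vanishingIdeal_of_regularPoint υ₁ hy hυ₁ hamb (𝓢.comap jG) (K.comap jG) h𝓢y hKy Z hD hyreg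
    rw [e₁, e₂]
    congr 1
    exact Closeds.ext closure_closure.symm
  -- (ii) flat over `O`
  have hii₂ : Flat ((strictTransformIdeal τ s.ker 𝓢 ⊔ strictTransformIdeal τ s.ker K).subschemeι ≫ (τ ≫ σ) ≫ q) :=
    flat_carrierStrictTransform_subschemeι_comp_stage O σ q s hs τ hτ 𝓢 K hii c hcJ h𝓢c Φ hΦ1 hKc ϖ hϖ h𝔪c hdim' hΦ𝔪
  -- (iii) regular carrier, principal stalks
  obtain ⟨⟨hiii₂, hiiip₂⟩, -⟩ := member_clause_iii_strictTransform_section O (σ ≫ q) s hs hXreg hτ 𝓢 K hle h𝓢0 ⟨hiii, hiiip⟩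
  -- (iv) off the generic point of `Y`
  have hsupp₂ : ((strictTransformIdeal τ s.ker 𝓢 ⊔ strictTransformIdeal τ s.ker K).support : Set X₂) ⊆
      τ ⁻¹' ((𝓢 ⊔ K).support : Set X) := by
    intro z hz
    have h1 : z ∈ (((𝓢 ⊔ K).comap τ).support : Set X₂) := by
      refine Scheme.IdealSheafData.support_antitone ?_ hz
      rw [Scheme.IdealSheafData.comap_sup]
      exact sup_le_sup (comap_le_strictTransformIdeal τ s.ker 𝓢) (comap_le_strictTransformIdeal τ s.ker K)
    rw [Scheme.IdealSheafData.support_comap] at h1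
    exact h1
  have hiv₂ : (τ ≫ σ) '' ((strictTransformIdeal τ s.ker 𝓢 ⊔ strictTransformIdeal τ s.ker K).support : Set X₂) ⊆
      {x : P | ¬ IsGenericPoint x Y} := by
    rintro _ ⟨z, hz, rfl⟩
    rw [Scheme.Hom.comp_apply]
    exact hiv ⟨τ z, hsupp₂ hz, rfl⟩
  -- (v) regular quotient stalks off the excluded points
  have hEX : ∀ z : X₂, τ z ∉ (s.ker.support : Set X) → τ z ∈ jG '' excl → z ∈ j₂ '' (υ₁ ⁻¹' excl) := by
    rintro z hzc ⟨y₀, hy₀, hy₀z⟩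
    have hy₀ne : y₀ ∉ (((vanishingIdeal ⟨{y}, hy⟩ : G.IdealSheafData)).support : Set G) := by
      rw [Scheme.IdealSheafData.coe_support_vanishingIdeal]
      rintro (rfl : y₀ = y)
      apply hzc
      rw [← hy₀z, ← hss₀, hCsupp]
      exact ⟨_, rfl⟩
    obtain ⟨y₀₂, hy₀₂⟩ := exists_preimage_of_not_mem_support υ₁ (vanishingIdeal ⟨{y}, hy⟩) hυ₁ hy₀ne
    have h1 : τ (j₂ y₀₂) = τ z := by rw [← Scheme.Hom.comp_apply, hcomm, Scheme.Hom.comp_apply, hy₀₂, hy₀z]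
    obtain ⟨z', -, huniq⟩ := existsUnique_preimage τ hτ.isIso_compl (W := centreCompl s.ker) (y := τ z) hzc
    refine ⟨y₀₂, show υ₁ y₀₂ ∈ excl by rw [hy₀₂]; exact hy₀, ?_⟩
    rw [huniq (j₂ y₀₂) h1, ← huniq z rfl]
  have hv₂ := member_clause_v_carrierStrictTransform O σ q s hs hτ 𝓢 K c hcJ hcq hcb h𝓢c Φ hΦ1 hΦc hKc hDreg' hDdim' g hgC hg0 hCg
    (jG '' excl) (j₂ '' (υ₁ ⁻¹' excl)) hEX hv
  -- (vi) the centred packages at the excluded points, transported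
  have hvi₂ : ∀ y₀₂ ∈ υ₁ ⁻¹' excl, TCPlus.CentredPackage O P q X₂ (τ ≫ σ) (strictTransformIdeal τ s.ker 𝓢)
      (strictTransformIdeal τ s.ker K) (j₂ y₀₂) := by
    intro y₀₂ hy₀₂
    have hy₀ : υ₁ y₀₂ ∈ excl := hy₀₂
    exact hpkg σ hXreg s hs τ hτ 𝓢 K (jG (υ₁ y₀₂)) (hexcl_off _ hy₀) (j₂ y₀₂)
      (by rw [← Scheme.Hom.comp_apply, hcomm, Scheme.Hom.comp_apply]) (hvi _ hy₀)
  -- the new running curve is not inside the new `closure Z₂`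
  have hT₂Z₂ : ¬ closure (υ₁ ⁻¹' (T \ {y})) ⊆ closure (closure (υ₁ ⁻¹' (Z \ {y}))) := by
    rw [closure_closure]
    intro hsub
    have h1 : T \ {y} ⊆ closure Z := by
      intro t ht
      have htne : t ∉ (((vanishingIdeal ⟨{y}, hy⟩ : G.IdealSheafData)).support : Set G) := by
        rw [Scheme.IdealSheafData.coe_support_vanishingIdeal]; exact ht.2
      obtain ⟨t₂, ht₂⟩ := exists_preimage_of_not_mem_support υ₁ (vanishingIdeal ⟨{y}, hy⟩) hυ₁ htne
      have h2 : t₂ ∈ closure (υ₁ ⁻¹' (Z \ {y})) := hsub (subset_closure (by rw [Set.mem_preimage, ht₂]; exact ht))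
      have h3 : closure (υ₁ ⁻¹' (Z \ {y})) ⊆ υ₁ ⁻¹' closure Z :=
        closure_minimal (fun u hu => subset_closure hu.1) (isClosed_closure.preimage υ₁.continuous)
      have h4 := h3 h2
      rw [Set.mem_preimage, ht₂] at h4
      exact h4
    have h2 : T ⊆ closure Z ∪ {y} := fun t ht => by
      by_cases hty : t = y
      · exact Or.inr hty
      · exact Or.inl (h1 ⟨ht, hty⟩)
    rcases (isPreirreducible_iff_isClosed_union_isClosed.mp hTirr.isPreirreducible) _ _ isClosed_closure hy h2 with h | h
    · exact hTZ h
    · exact hTx h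
  -- (viii) the carrier still cuts an effective Cartier divisor on the cone: the pointwise Cartier datum at the CLOSED points of
  -- `V(St K) ∩ supp St 𝓢` — over the centre by unique factorisation from clause (v) (codimension two), elsewhere transported from the
  -- old (viii) along the stalk isomorphisms of `τ` — then `isEffectiveCartier_comap_subschemeι_of_forall_isClosed`
  have hviii₂ : IsEffectiveCartier ((strictTransformIdeal τ s.ker 𝓢).comap (strictTransformIdeal τ s.ker K).subschemeι) := by
    haveI : CompactSpace ↥X₂ := by
      haveI : IsProper ((τ ≫ σ) ≫ q) := by rw [Category.assoc]; infer_instance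
      exact QuasiCompact.compactSpace_of_compactSpace ((τ ≫ σ) ≫ q)
    refine isEffectiveCartier_comap_subschemeι_of_forall_isClosed _ _ fun z hzc hzK hz𝓢 => ?_
    have hsp : ((τ ≫ σ) ≫ q) z = closedPoint O :=
      eq_closedPoint_of_isClosed_singleton (by simpa only [Set.image_singleton] using ((τ ≫ σ) ≫ q).isClosedMap _ hzc)
    obtain ⟨f₁, hf₁⟩ := (hiiip₂ z).2
    obtain ⟨h₁, hh₁⟩ := (hiiip₂ z).1
    change stalkIdeal (strictTransformIdeal τ s.ker K) z = Ideal.span {f₁} at hf₁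
    change stalkIdeal (strictTransformIdeal τ s.ker 𝓢) z = Ideal.span {h₁} at hh₁
    by_cases hzc₀ : τ z ∈ (s.ker.support : Set X)
    · -- over the centre: `τ z = jG y`; codimension two by clause (v) of the new member
      have hτz : τ z = jG y := by
        rw [hCsupp] at hzc₀
        obtain ⟨u, hu⟩ := hzc₀
        have hu' : u = closedPoint O := by
          rw [← hrs u, hu, ← Scheme.Hom.comp_apply, ← Category.assoc]
          exact hsp
        rw [← hu, hu', hss₀]
      have hnot : z ∉ j₂ '' (υ₁ ⁻¹' excl) := by
        rintro ⟨w, hw, rfl⟩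
        have h1 : jG (υ₁ w) = jG y := by rw [← Scheme.Hom.comp_apply, ← hcomm, Scheme.Hom.comp_apply]; exact hτz
        exact hyexcl (hjci.isClosedEmbedding.injective h1 ▸ hw)
      have hzsupp : z ∈ ((strictTransformIdeal τ s.ker 𝓢 ⊔ strictTransformIdeal τ s.ker K).support : Set X₂) :=
        mem_support_sup_of_mem _ _ hz𝓢 hzK
      obtain ⟨-, hcod⟩ := hv₂ z hzsupp hsp hnot
      have hdim₂ := hcod hzc
      rw [stalkIdeal_sup, hh₁, hf₁] at hdim₂
      have hR : ringKrullDim (X₂.presheaf.stalk z) = ((2 + 2 : ℕ) : WithBot ℕ∞) :=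
        ringKrullDim_stalk_eq_succ_of_chain q 3 hξ (hChain _ _ _ hCh₂) hzc (by
          simpa only [Scheme.Hom.comp_base, TopCat.coe_comp, Function.comp_apply] using hsp)
      haveI := hX₂reg z
      exact ⟨f₁, h₁, hf₁, hh₁, cartierDatum_of_codimTwo hR hdim₂⟩
    · -- off the centre: transport the old datum along `τ`
      have hτzK : τ z ∈ (K.support : Set X) := by
        have h1 := Scheme.IdealSheafData.support_antitone (comap_le_strictTransformIdeal τ s.ker K) hzK
        rw [Scheme.IdealSheafData.support_comap] at h1
        exact h1
      obtain ⟨w₀, hw₀⟩ : ∃ w₀ : ↥K.subscheme, K.subschemeι w₀ = τ z := by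
        rw [← Set.mem_range, Scheme.IdealSheafData.range_subschemeι]; exact hτzK
      obtain ⟨f₀, hf₀⟩ := (hiiip (τ z)).2
      obtain ⟨h₀, hh₀⟩ := (hiiip (τ z)).1
      change stalkIdeal K (τ z) = Ideal.span {f₀} at hf₀
      change stalkIdeal 𝓢 (τ z) = Ideal.span {h₀} at hh₀
      have hd₀ := datum_of_mem_cartierLocus_subschemeι 𝓢 K w₀ hw₀ (hviii.mem_cartierLocus w₀) f₀ h₀ hf₀ hh₀
      obtain ⟨hK', h𝓢', hnzd'⟩ := datum_strictTransform_of_not_mem_support hτ 𝓢 K hzc₀ f₀ h₀ hf₀ hh₀ hd₀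
      exact ⟨_, _, hK', h𝓢', hnzd'⟩
  -- (ix) THE PLANE TRACE steps as the reduced strict transform of the closed plane: carrier-alone exactness (res-type-027
  -- `comap_strictTransformIdeal_carrier_eq_of_regularPoint`), then `St_υ 𝓘⟨closure S_d⟩ = 𝓘⟨closure υ₁⁻¹(closure S_d ∖ {y})⟩`
  have hix₂ : (strictTransformIdeal τ s.ker 𝓢).comap j₂ =
      vanishingIdeal ⟨closure (closure (υ₁ ⁻¹' (Sd \ {y}))), isClosed_closure⟩ := by
    rw [comap_strictTransformIdeal_carrier_eq_of_regularPoint O k θ hθ (σ ≫ q) jG tG hsq s hs τ hτ υ₁ j₂ hcomm y hy hυ₁ hJ hss₀ hreg ϖ hϖ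
        𝓢 K hle h𝓢p hKp hDreg hDdim, hix, strictTransformIdeal_vanishingIdeal_eq υ₁ _ hυ₁]
    congr 1
    apply Closeds.ext
    change closure (υ₁ ⁻¹' (closure Sd \ ((vanishingIdeal (⟨{y}, hy⟩ : Closeds G)).support : Set G))) =
      closure (closure (υ₁ ⁻¹' (Sd \ {y})))
    rw [Scheme.IdealSheafData.coe_support_vanishingIdeal, closure_closure]
    exact closure_preimage_closure_diff_singleton hy hυ₁ Sd
  -- (x) the plane's model stays `O`-flat: T-STFLAT-GEN (res-L1-w45b-stub-2 `flat_strictTransform_subschemeι_comp_stage`)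
  have hx₂ : Flat ((strictTransformIdeal τ s.ker 𝓢).subschemeι ≫ (τ ≫ σ) ≫ q) :=
    flat_strictTransform_subschemeι_comp_stage O σ q τ s.ker hτ 𝓢 hSflat
  -- the `{jG y}`-fibre fact of the section centre (for the planes' AWAY transports in the same stage)
  have hCb : (s.ker.support : Set X) ∩ (σ ≫ q) ⁻¹' {closedPoint O} = {jG y} := by
    ext z
    constructor
    · rintro ⟨hz, hzsp⟩
      rw [hCsupp] at hz
      obtain ⟨p, rfl⟩ := hz
      have hp : p = closedPoint O := by rw [← hrs p]; exact hzsp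
      rw [Set.mem_singleton_iff, hp, hss₀]
    · rintro rfl
      refine ⟨?_, hjsp y⟩
      rw [hCsupp, ← hss₀]; exact ⟨_, rfl⟩
  exact ⟨s, X₂, τ, j₂, t₂, hs, hss₀, hτ, hcomm, hCb, hG₂int, hirr₂, hT₂Z₂, hCh₂, hX₂int,
    hX₂noeth, hX₂reg, hdom₂, hsq₂, hS₂, hi₂, hii₂, hiii₂, hiiip₂, hiv₂, hv₂, hvi₂, hviii₂, hix₂, hx₂⟩

end Summit.ResolutionOfSingularities.ResolutionOfSingularities.Cruxes.EquisingularLiftNat.Sections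

end
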